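import Mathlib
import HarnessLib

/-!
# Pull-back of the ideal of a section to a reduced subscheme of the special fibre

Helper `ker_section_comap_eq_vanishingIdeal` (sub-goal G2a of `stub_resolveOnePoint_dimOne`) of the
line `strata-split` for the crux `EquisingularLift` (stmt-ResolutionOfSingularities-15660).

Let `O` be a discrete valuation ring (only "local" is used), `r : U → Spec O` separated,
`s : Spec O → U` a section of `r` (a closed immersion, `C := s(Spec O)`), and `i : Z ↪ U` a closed
immersion from a reduced scheme `Z` whose image lies over the closed point of `Spec O`, with
`i z₀ = s(𝔪)`. Then the pulled-back ideal sheaf `s.ker.comap i` (the ideal of `Z ×_U C ↪ Z`) is the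
vanishing ideal of the closed, reduced point `z₀`: the section meets `Z` transversally.

Proof: `s.ker.comap i = ker (p₁ : Z ×_U C → Z)` (`ker_fst_of_isClosedImmersion`). The scheme
`P := Z ×_U C` is reduced: `p₂ : P → Spec O` is a closed immersion (base change of `i`), so `P` is
affine and `O → Γ(P)` is surjective; since `p₂ = p₁ ≫ i ≫ r` and `i ≫ r` maps `Z` into the closed
point, every `a ∈ 𝔪` has empty basic open on the reduced scheme `Z`, hence vanishes on `Z` and on
`P`; so `Γ(P)` is a quotient of the residue field `O/𝔪`, hence reduced. Therefore `ker p₁` is a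
radical ideal sheaf and equals the vanishing ideal of its support
`closure (range p₁) = closure (i ⁻¹' range s) = {z₀}`.

References: A. Grothendieck, J. Dieudonné, *EGA I* (1971), 4.4 (inverse image of a closed
subscheme), 5.1.8 (reduced subschemes); U. Görtz, T. Wedhorn, *Algebraic Geometry I* (2nd ed.,
2020), §4.4 (schematic intersection / inverse image).
-/

set_option linter.dupNamespace false -- mandated namespace of this single-conjunct summit
set_option linter.overlappingInstances false -- registered signature carries `[IsDomain O] [IsDiscreteValuationRing O]` (Mathlib's class takes the former as a parameter)

namespace Summit.ResolutionOfSingularities.ResolutionOfSingularities.Cruxes.EquisingularLift.StrataSplit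

open CategoryTheory CategoryTheory.Limits AlgebraicGeometry TopologicalSpace

universe u

/-- If `g : Z → Spec O` (`O` local) has set-theoretic image in the closed point and `Z` is reduced,
then every `a ∈ 𝔪_O` pulls back to `0` in `Γ(Z, ⊤)` (its basic open `g ⁻¹ D(a)` is empty).
[folklore] -/
theorem appTop_eq_zero_of_range_subset_closedPoint {O : Type u} [CommRing O] [IsLocalRing O]
    {Z : Scheme.{u}} [IsReduced Z] (g : Z ⟶ Spec (.of O))
    (hg : Set.range g ⊆ {IsLocalRing.closedPoint O}) {a : O}
    (ha : a ∈ IsLocalRing.maximalIdeal O) :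
    g.appTop ((Scheme.ΓSpecIso (.of O)).inv a) = 0 := by
  rw [← basicOpen_eq_bot_iff, ← Scheme.preimage_basicOpen_top, basicOpen_eq_of_affine]
  refine eq_bot_iff.mpr fun z hz => ?_
  have hz' : g z ∈ PrimeSpectrum.basicOpen a := hz
  rw [show g z = IsLocalRing.closedPoint O from hg ⟨z, rfl⟩] at hz'
  exact absurd ha ((PrimeSpectrum.mem_basicOpen a (IsLocalRing.closedPoint O)).mp hz')

/-- If `p : P → Spec O` (`O` local) is a closed immersion killing the maximal ideal on global
sections, then `P` is reduced (it is `Spec` of a quotient of the residue field `O/𝔪`).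
[folklore] -/
theorem isReduced_of_isClosedImmersion_of_maximalIdeal_le_ker {O : Type u} [CommRing O]
    [IsLocalRing O] {P : Scheme.{u}} (p : P ⟶ Spec (.of O)) [IsClosedImmersion p]
    (hp : ∀ a ∈ IsLocalRing.maximalIdeal O, p.appTop ((Scheme.ΓSpecIso (.of O)).inv a) = 0) :
    IsReduced P := by
  obtain ⟨hP, hsurj⟩ := IsClosedImmersion.isAffine_surjective_of_isAffine p
  have : _root_.IsReduced Γ(P, ⊤) := by
    refine ⟨fun x hx => ?_⟩
    obtain ⟨t, rfl⟩ := hsurj x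
    obtain ⟨a, rfl⟩ : ∃ a : O, (Scheme.ΓSpecIso (.of O)).inv a = t :=
      ⟨(Scheme.ΓSpecIso (.of O)).hom t, by simp⟩
    by_cases ha : a ∈ IsLocalRing.maximalIdeal O
    · exact hp a ha
    · have hu : IsUnit a := of_not_not fun h => ha ((IsLocalRing.mem_maximalIdeal a).mpr h)
      have hu' : IsUnit (p.appTop ((Scheme.ΓSpecIso (.of O)).inv a)) :=
        (hu.map (Scheme.ΓSpecIso (.of O)).inv.hom).map p.appTop.hom
      obtain ⟨n, hn⟩ := hx
      have h0 : IsUnit (0 : Γ(P, ⊤)) := hn ▸ hu'.pow n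
      exact eq_zero_of_zero_eq_one (isUnit_zero_iff.mp h0) _
  exact isReduced_of_isAffine_isReduced P

/-- **Transversality of a section to the special fibre.** Let `O` be a discrete valuation ring,
`r : U → Spec O` separated with a section `s`, `i : Z ↪ U` a closed immersion from a reduced
scheme lying over the closed point of `Spec O`, and `z₀ ∈ Z` the point with `i z₀ = s(𝔪)`. Then
the pull-back to `Z` of the ideal sheaf of the section (the ideal of `Z ×_U s(Spec O) ↪ Z`) is the
vanishing ideal of the reduced closed point `z₀`. [folklore] -/
theorem ker_section_comap_eq_vanishingIdeal : ∀ (O : Type) [CommRing O] [IsDomain O] [IsDiscreteValuationRing O] (U Z : AlgebraicGeometry.Scheme.{0}) (r : U ⟶ AlgebraicGeometry.Spec (.of O)) [AlgebraicGeometry.IsSeparated r] (s : AlgebraicGeometry.Spec (.of O) ⟶ U), CategoryTheory.CategoryStruct.comp s r = CategoryTheory.CategoryStruct.id _ → ∀ (i : Z ⟶ U) [AlgebraicGeometry.IsClosedImmersion i] [AlgebraicGeometry.IsReduced Z], Set.range ⇑(CategoryTheory.CategoryStruct.comp i r) ⊆ {IsLocalRing.closedPoint O} → ∀ (z₀ :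 Z), i z₀ = s (IsLocalRing.closedPoint O) → ∀ (hcl : IsClosed ({z₀} : Set Z)), s.ker.comap i = AlgebraicGeometry.Scheme.IdealSheafData.vanishingIdeal ⟨{z₀}, hcl⟩ := by
  intro O _ _ _ U Z r _ s hs i _ _ hrange z₀ hz₀ hcl
  -- the section `s` of the separated `r` is a closed immersion
  haveI : IsClosedImmersion (s ≫ r) := by rw [hs]; infer_instance
  haveI : IsClosedImmersion s := .of_comp s r
  -- `s.ker.comap i` is the kernel of `p₁ : P := Z ×_U Spec O ⟶ Z`
  rw [← Scheme.IdealSheafData.ker_fst_of_isClosedImmersion s i]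
  have hp₂ : pullback.snd i s = pullback.fst i s ≫ i ≫ r := by
    rw [← Category.assoc, pullback.condition, Category.assoc, hs, Category.comp_id]
  -- `P` is reduced: `O → Γ(P)` is onto and kills `𝔪`
  haveI : IsReduced (pullback i s) := by
    refine isReduced_of_isClosedImmersion_of_maximalIdeal_le_ker (pullback.snd i s) fun a ha => ?_
    rw [hp₂, Scheme.Hom.comp_appTop, CommRingCat.comp_apply,
      appTop_eq_zero_of_range_subset_closedPoint (i ≫ r) hrange ha, map_zero]
  -- hence `ker p₁` is a radical ideal sheaf
  have hrad : (pullback.fst i s).ker.radical = (pullback.fst i s).ker := by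
    ext W : 2
    rw [Scheme.IdealSheafData.radical_ideal, Scheme.Hom.ker_apply]
    exact (Ideal.isRadical_bot.comap (Scheme.Hom.app (pullback.fst i s) W).hom).radical
  -- whose support is `closure (range p₁) = closure (i ⁻¹' range s) = {z₀}`
  have hsr : ∀ p, r (s p) = p := fun p => by
    rw [← Scheme.Hom.comp_apply, hs]; simp
  have hpre : (⇑i) ⁻¹' Set.range ⇑s = {z₀} := by
    ext z
    simp only [Set.mem_preimage, Set.mem_range, Set.mem_singleton_iff]
    constructor
    · rintro ⟨p, hp⟩
      have hz : r (i z) = IsLocalRing.closedPoint O := by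
        rw [← Scheme.Hom.comp_apply]; exact hrange ⟨z, rfl⟩
      have hpc : p = IsLocalRing.closedPoint O := by
        rw [← hsr p, hp, hz]
      apply i.isClosedEmbedding.injective
      rw [hz₀, ← hp, hpc]
    · rintro rfl
      exact ⟨_, hz₀.symm⟩
  have hsupp : (pullback.fst i s).ker.support = ⟨{z₀}, hcl⟩ := by
    ext1
    rw [Scheme.Hom.support_ker, Scheme.Pullback.range_fst, hpre, hcl.closure_eq]
    rfl
  rw [← hrad, ← Scheme.IdealSheafData.vanishingIdeal_support, hsupp]

end Summit.ResolutionOfSingularities.ResolutionOfSingularities.Cruxes.EquisingularLift.StrataSplit
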